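import Mathlib.RingTheory.Artinian.Module
import Mathlib.LinearAlgebra.Eigenspace.Charpoly
import Mathlib.LinearAlgebra.Dual.Lemmas
import Mathlib.LinearAlgebra.Contraction
import Literature.NumberTheory.Automorphic.LocalConstants
import Literature.NumberTheory.GaloisRepresentations.WeilDeligneRepProofs
import Summits.Langlands.Langlands.Theorems.DyadicOddResidueSectorComplementStubEulerFactorIso
import HarnessLib

/-!
# Stub `stub_exists_eulerFactor_tprod_ne_one_of_not_isIrreducible` for line `Sketch`
# (crux stmt-Langlands-17925 `IrreducibilityBySelfDuality.ReciprocityUpToIrreducibilityR`)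

**Henniart's irreducibility criterion, elementary half** (Bull. SMF 130 (2002), Thm 1.6 (a),
(ii) ⇒ (i)): a Frobenius-semisimple Weil–Deligne representation `φ = (ρ, N)` on a non-zero
finite-dimensional complex space `V` which is NOT irreducible admits an irreducible
Frobenius-semisimple probe `τ` on `Fin m → ℂ`, `0 < m < dim V`, with `(φ.tprod τ).eulerFactor ≠ 1`.

Proof (Tate, Corvallis 1979, (4.1.5)–(4.1.6)).  (1) `ker N ≠ 0` is `ρ(W_F)`-stable; a MINIMAL
non-zero `ρ(W_F)`-stable `T ≤ ker N` (well-founded lattice of subspaces) is a sub-Weil–Deligne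
representation with `N_T = 0`, irreducible under `W_F`, and `T ≠ V` since `φ` is reducible.
(2) The probe is the contragredient `T^∨` — irreducible (finite-dimensional duality) and
Frobenius-semisimple (the transpose of a semisimple endomorphism is semisimple: square-free
minimal polynomial) — transported to `Fin m → ℂ` along a linear equivalence.  (3) Under
`V ⊗ T^∨ ≃ Hom(T, V)` the inclusion `T ↪ V` is a non-zero vector of `φ ⊗ T^∨` fixed by `W_F` and
killed by `N ⊗ 1 + 1 ⊗ N^∨ = N ⊗ 1`; it lies in `(ker N)^{I_F}` and is fixed by the geometric
Frobenius, so `1` is a root of the characteristic polynomial of `Φ | (ker N)^{I_F}`, whose reverse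
is the Euler factor; the Euler factor is an isomorphism invariant
(`ReciprocityRigidity.stub_eulerFactor_eq_of_isEquivalent`).  No definitions, no named facts.
-/

noncomputable section

set_option linter.dupNamespace false

open scoped TensorProduct Polynomial
open Module Polynomial
open Literature.NumberTheory.Automorphic Literature.NumberTheory.GaloisRepresentations
open Summit.Langlands.Langlands.Theorems.ReciprocityRigidity

namespace Summit.Langlands.Langlands.Theorems.ReciprocityUpToIrreducibilityR

/-- Polynomials commute with transposition: `p(fᵀ) = p(f)ᵀ`. [folklore] -/
theorem aeval_dualMap {K : Type*} [Field K] {M : Type*} [AddCommGroup M] [Module K M]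
    (f : Module.End K M) (p : K[X]) : aeval f.dualMap p = (aeval f p).dualMap := by
  simp only [aeval_eq_sum_range, LinearMap.dualMap_def, map_sum, map_smul]
  refine Finset.sum_congr rfl fun i _ => ?_
  rw [← LinearMap.dualMap_def, ← LinearMap.dualMap_def, LinearMap.dualMap_pow]

/-- The transpose of a semisimple endomorphism of a finite-dimensional vector space is
semisimple (same square-free minimal polynomial). [folklore] -/
theorem isSemisimple_dualMap {K : Type*} [Field K] {M : Type*} [AddCommGroup M] [Module K M]
    [FiniteDimensional K M] {f : Module.End K M} (hf : f.IsSemisimple) :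
    Module.End.IsSemisimple f.dualMap :=
  Module.End.isSemisimple_of_squarefree_aeval_eq_zero hf.minpoly_squarefree
    (by rw [aeval_dualMap, minpoly.aeval, LinearMap.dualMap_def, map_zero])

/-- `p.reverse (1) = 0 ↔ p (1) = 0`. [folklore] -/
theorem eval_one_reverse_eq_zero_iff {K : Type*} [Field K] (p : K[X]) :
    p.reverse.eval 1 = 0 ↔ p.eval 1 = 0 := by
  letI : Invertible (1 : K) := invertibleOne
  have h := eval₂_reverse_eq_zero_iff (RingHom.id K) (1 : K) p
  rwa [invOf_one', eval₂_id, eval₂_id] at h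

/-- A nilpotent endomorphism of a non-zero module has a non-zero kernel. [folklore] -/
theorem ker_ne_bot_of_isNilpotent {K : Type*} [Field K] {M : Type*} [AddCommGroup M] [Module K M]
    [Nontrivial M] {f : Module.End K M} (hf : IsNilpotent f) : LinearMap.ker f ≠ ⊥ := by
  intro h
  obtain ⟨k, hk⟩ := hf
  have hinj : Function.Injective (f ^ k) :=
    Module.End.iterate_injective (LinearMap.ker_eq_bot.mp h) k
  rw [hk] at hinj
  obtain ⟨v, hv⟩ := exists_ne (0 : M)
  exact hv (hinj (by simp))

/-- Frobenius-semisimplicity is an isomorphism invariant. [folklore] -/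
theorem isFrobSemisimple_of_equiv
    {F : Type} [Field F] [ValuativeRel F] [TopologicalSpace F] [IsNonarchimedeanLocalField F]
    {V : Type*} [AddCommGroup V] [Module ℂ V] {V' : Type*} [AddCommGroup V'] [Module ℂ V']
    {r : WeilDeligneRep F ℂ V} {r' : WeilDeligneRep F ℂ V'} (e : r.Equiv r')
    (h : r.IsFrobSemisimple) : r'.IsFrobSemisimple := fun w =>
  (LinearEquiv.isSemisimple_iff (r.ρ w) (r'.ρ w) e.toLinearEquiv (e.isIntertwining' w)).mp (h w)

/-- The preimage of a sub-Weil–Deligne representation under an isomorphism is a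
sub-Weil–Deligne representation. [folklore] -/
theorem isSubrep_comap_of_equiv
    {F : Type} [Field F] [ValuativeRel F] [TopologicalSpace F] [IsNonarchimedeanLocalField F]
    {V : Type*} [AddCommGroup V] [Module ℂ V] {V' : Type*} [AddCommGroup V'] [Module ℂ V']
    {r : WeilDeligneRep F ℂ V} {r' : WeilDeligneRep F ℂ V'} (e : r.Equiv r')
    {p : Submodule ℂ V'} (hp : r'.IsSubrep p) :
    r.IsSubrep (p.comap (e.toLinearEquiv : V →ₗ[ℂ] V')) := by
  refine ⟨fun w v hv => ?_, fun v hv => ?_⟩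
  · change e.toLinearEquiv (r.ρ w v) ∈ p
    rw [eulerIso_ρ_apply]
    exact hp.1 w hv
  · change e.toLinearEquiv (r.N v) ∈ p
    rw [eulerIso_N_apply]
    exact hp.2 hv

/-- Irreducibility is an isomorphism invariant. [folklore] -/
theorem isIrreducible_of_equiv
    {F : Type} [Field F] [ValuativeRel F] [TopologicalSpace F] [IsNonarchimedeanLocalField F]
    {V : Type*} [AddCommGroup V] [Module ℂ V] {V' : Type*} [AddCommGroup V'] [Module ℂ V']
    {r : WeilDeligneRep F ℂ V} {r' : WeilDeligneRep F ℂ V'} (e : r.Equiv r')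
    (h : r.IsIrreducible) : r'.IsIrreducible := by
  haveI := h.1
  refine ⟨e.toLinearEquiv.injective.nontrivial, fun p hp => ?_⟩
  have hsurj : Function.Surjective (e.toLinearEquiv : V →ₗ[ℂ] V') := e.toLinearEquiv.surjective
  have hpe : (p.comap (e.toLinearEquiv : V →ₗ[ℂ] V')).map (e.toLinearEquiv : V →ₗ[ℂ] V') = p :=
    Submodule.map_comap_eq_of_surjective hsurj p
  rcases h.2 _ (isSubrep_comap_of_equiv e hp) with h0 | h1
  · exact Or.inl (by rw [← hpe, h0, Submodule.map_bot])
  · exact Or.inr (by rw [← hpe, h1, Submodule.map_top, LinearMap.range_eq_top]; exact hsurj)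

/-- Transport of a Weil–Deligne representation with `N = 0` along a linear equivalence
`e : W ≃ X`: `(e ρ e⁻¹, 0)` on `X` is isomorphic to `(ρ, 0)`. [folklore] -/
theorem exists_isEquivalent_of_linearEquiv
    {F : Type} [Field F] [ValuativeRel F] [TopologicalSpace F] [IsNonarchimedeanLocalField F]
    {W : Type*} [AddCommGroup W] [Module ℂ W] {X : Type*} [AddCommGroup X] [Module ℂ X]
    (r : WeilDeligneRep F ℂ W) (hN : r.N = 0) (e : W ≃ₗ[ℂ] X) :
    ∃ r' : WeilDeligneRep F ℂ X, r.IsEquivalent r' := by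
  let ρ' : Representation ℂ (WeilGroup F) X := e.conjRingEquiv.toMonoidHom.comp r.ρ
  have hρ' : ∀ w, ρ' w = (e : W →ₗ[ℂ] X) ∘ₗ r.ρ w ∘ₗ (e.symm : X →ₗ[ℂ] W) := fun w => rfl
  have hc : WeilGroup.IsContinuousRep ρ' := by
    obtain ⟨U, hU, hUo, hρ⟩ := r.isContinuous
    refine ⟨U, hU, hUo, fun u hu => ?_⟩
    rw [hρ', hρ u hu]; ext; simp
  refine ⟨WeilDeligneRep.ofRep ρ' hc,
    ⟨{ toRepEquiv := Representation.Equiv.mk e fun w => ?_, comm_N := ?_ }⟩⟩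
  · change (e : W →ₗ[ℂ] X) ∘ₗ r.ρ w = ρ' w ∘ₗ (e : W →ₗ[ℂ] X)
    rw [hρ']; ext; simp
  · ext; simp [hN]

/-- `ker N` is `ρ(W_F)`-stable: `N (ρ w v) = q^{-deg w} ρ w (N v)`.
[cite: TateCorvallis1979, (4.1.5)] -/
theorem ker_N_le_comap
    {F : Type} [Field F] [ValuativeRel F] [TopologicalSpace F] [IsNonarchimedeanLocalField F]
    {V : Type*} [AddCommGroup V] [Module ℂ V] (r : WeilDeligneRep F ℂ V) (w : WeilGroup F) :
    LinearMap.ker r.N ≤ (LinearMap.ker r.N).comap (r.ρ w) := by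
  intro v hv
  simp only [Submodule.mem_comap, LinearMap.mem_ker] at hv ⊢
  have h := r.ρ_N_apply w v
  rw [hv, map_zero] at h
  exact (smul_eq_zero.mp h.symm).resolve_left (WeilDeligneRep.residueFieldCard_zpow_ne_zero _)

/-- A `ρ(W_F)`-stable subspace `T` of `ker N` is a sub-Weil–Deligne representation, and the
sub-Weil–Deligne representation on `T` has `N = 0`. [folklore] -/
theorem isSubrep_of_le_ker
    {F : Type} [Field F] [ValuativeRel F] [TopologicalSpace F] [IsNonarchimedeanLocalField F]
    {V : Type*} [AddCommGroup V] [Module ℂ V] (r : WeilDeligneRep F ℂ V) {T : Submodule ℂ V}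
    (hst : ∀ w, T ≤ T.comap (r.ρ w)) (hker : T ≤ LinearMap.ker r.N) :
    ∃ hT : r.IsSubrep T, (r.ofSubrep T hT).N = 0 := by
  refine ⟨⟨hst, fun v hv => ?_⟩, ?_⟩
  · simp only [Submodule.mem_comap, LinearMap.mem_ker.mp (hker hv)]
    exact T.zero_mem
  · ext ⟨v, hv⟩
    exact LinearMap.mem_ker.mp (hker hv)

/-- A sub-Weil–Deligne representation of a Frobenius-semisimple one is Frobenius-semisimple
(restriction of a semisimple endomorphism to an invariant subspace). [folklore] -/
theorem isFrobSemisimple_ofSubrep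
    {F : Type} [Field F] [ValuativeRel F] [TopologicalSpace F] [IsNonarchimedeanLocalField F]
    {V : Type*} [AddCommGroup V] [Module ℂ V] (r : WeilDeligneRep F ℂ V) {T : Submodule ℂ V}
    (hT : r.IsSubrep T) (h : r.IsFrobSemisimple) : (r.ofSubrep T hT).IsFrobSemisimple := fun w =>
  (h w).restrict ((Module.End.mem_invtSubmodule _).mpr (hT.1 w))

/-- The contragredient of a Frobenius-semisimple representation is Frobenius-semisimple
(`ρ^∨(w) = ρ(w⁻¹)ᵀ`, transpose of a semisimple endomorphism). [folklore] -/
theorem isFrobSemisimple_dual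
    {F : Type} [Field F] [ValuativeRel F] [TopologicalSpace F] [IsNonarchimedeanLocalField F]
    (hmul' : @IsFrobPow.mul F _ _ _ _) (huniq' : @IsFrobPow.unique F _ _ _ _)
    {V : Type*} [AddCommGroup V] [Module ℂ V] [FiniteDimensional ℂ V] (r : WeilDeligneRep F ℂ V)
    (h : r.IsFrobSemisimple) : (r.dual hmul' huniq').IsFrobSemisimple := fun w => by
  rw [WeilDeligneRep.dual_ρ, Representation.dual_apply, ← LinearMap.dualMap_def]
  exact isSemisimple_dualMap (h w⁻¹)

/-- **Existence of a minimal non-zero `ρ(W_F)`-stable subspace of `ker N`** (finite dimension: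
the lattice of subspaces is well-founded). [folklore] -/
theorem exists_minimal_stable_le_ker
    {F : Type} [Field F] [ValuativeRel F] [TopologicalSpace F] [IsNonarchimedeanLocalField F]
    {V : Type*} [AddCommGroup V] [Module ℂ V] [FiniteDimensional ℂ V] [Nontrivial V]
    (r : WeilDeligneRep F ℂ V) :
    ∃ T : Submodule ℂ V, T ≠ ⊥ ∧ (∀ w, T ≤ T.comap (r.ρ w)) ∧ T ≤ LinearMap.ker r.N ∧
      ∀ T' : Submodule ℂ V, T' ≠ ⊥ → (∀ w, T' ≤ T'.comap (r.ρ w)) → T' ≤ T → T' = T := by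
  set S : Set (Submodule ℂ V) :=
    {p | p ≠ ⊥ ∧ (∀ w, p ≤ p.comap (r.ρ w)) ∧ p ≤ LinearMap.ker r.N}
  have hkerS : LinearMap.ker r.N ∈ S :=
    ⟨ker_ne_bot_of_isNilpotent r.isNilpotent_N, ker_N_le_comap r, le_rfl⟩
  obtain ⟨T, ⟨hT0, hTst, hTker⟩, hmin⟩ := WellFounded.has_min wellFounded_lt S ⟨_, hkerS⟩
  exact ⟨T, hT0, hTst, hTker, fun T' h0 hst hle =>
    eq_of_le_of_not_lt hle (hmin T' ⟨h0, hst, hle.trans hTker⟩)⟩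

/-- On a minimal non-zero stable `T`, every `ρ(W_F)`-stable subspace is `⊥` or `⊤`. [folklore] -/
theorem stable_ofSubrep_eq_bot_or_top
    {F : Type} [Field F] [ValuativeRel F] [TopologicalSpace F] [IsNonarchimedeanLocalField F]
    {V : Type*} [AddCommGroup V] [Module ℂ V] (r : WeilDeligneRep F ℂ V) {T : Submodule ℂ V}
    (hT : r.IsSubrep T)
    (hmin : ∀ T' : Submodule ℂ V, T' ≠ ⊥ → (∀ w, T' ≤ T'.comap (r.ρ w)) → T' ≤ T → T' = T)
    (q : Submodule ℂ T) (hq : ∀ w, q ≤ q.comap ((r.ofSubrep T hT).ρ w)) : q = ⊥ ∨ q = ⊤ := by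
  by_cases hq0 : q = ⊥
  · exact Or.inl hq0
  right
  have hinj : Function.Injective (Submodule.map T.subtype : Submodule ℂ T → Submodule ℂ V) :=
    Submodule.map_injective_of_injective T.injective_subtype
  have h0 : q.map T.subtype ≠ ⊥ := fun h => hq0 (hinj (by rw [h, Submodule.map_bot]))
  have hst : ∀ w, q.map T.subtype ≤ (q.map T.subtype).comap (r.ρ w) :=
    fun w _ ⟨x, hx, hx'⟩ => hx' ▸ ⟨(r.ofSubrep T hT).ρ w x, hq w hx, rfl⟩
  exact hinj (by rw [hmin _ h0 hst (Submodule.map_subtype_le T q), Submodule.map_subtype_top])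

/-- **The contragredient of an irreducible `W_F`-representation is irreducible**
(finite-dimensional duality: the co-annihilator of a stable subspace of the dual is stable).
[folklore] -/
theorem stable_dual_eq_bot_or_top
    {F : Type} [Field F] [ValuativeRel F] [TopologicalSpace F] [IsNonarchimedeanLocalField F]
    (hmul' : @IsFrobPow.mul F _ _ _ _) (huniq' : @IsFrobPow.unique F _ _ _ _)
    {V : Type*} [AddCommGroup V] [Module ℂ V] [FiniteDimensional ℂ V] (r : WeilDeligneRep F ℂ V)
    (h : ∀ q : Submodule ℂ V, (∀ w, q ≤ q.comap (r.ρ w)) → q = ⊥ ∨ q = ⊤)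
    (q : Submodule ℂ (Module.Dual ℂ V)) (hq : ∀ w, q ≤ q.comap ((r.dual hmul' huniq').ρ w)) :
    q = ⊥ ∨ q = ⊤ := by
  have hst : ∀ w, q.dualCoannihilator ≤ q.dualCoannihilator.comap (r.ρ w) := by
    intro w x hx
    simp only [Submodule.mem_comap, Submodule.mem_dualCoannihilator] at hx ⊢
    intro f hf
    simpa [Module.Dual.transpose_apply] using hx _ (hq w⁻¹ hf)
  rw [← Subspace.dualCoannihilator_dualAnnihilator_eq (W := q)]
  rcases h _ hst with h0 | h1
  · exact Or.inr (by rw [h0, Submodule.dualAnnihilator_bot])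
  · exact Or.inl (by rw [h1, Submodule.dualAnnihilator_top])

/-- **A `W_F`-fixed vector killed by `N` forces `eulerFactor ≠ 1`**: it lies in `(ker N)^{I_F}`
and is fixed by the geometric Frobenius `Φ`, so `1` is a root of the characteristic polynomial of
`Φ | (ker N)^{I_F}`, whose reverse is the Euler factor. [cite: TateCorvallis1979, (4.1.6)] -/
theorem eulerFactor_ne_one_of_fixed
    {F : Type} [Field F] [ValuativeRel F] [TopologicalSpace F] [IsNonarchimedeanLocalField F]
    (hn' : absInertia_normal F) (hex' : @exists_isFrobPow F _ _ _ _)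
    {V : Type*} [AddCommGroup V] [Module ℂ V] [FiniteDimensional ℂ V] (σ : WeilDeligneRep F ℂ V)
    {c : V} (hc0 : c ≠ 0) (hN : σ.N c = 0) (hρ : ∀ w, σ.ρ w c = c) :
    σ.eulerFactor hn' hex' ≠ 1 := by
  have hc : c ∈ σ.inertiaInvariantsKerN :=
    (σ.mem_inertiaInvariantsKerN_iff c).mpr ⟨hN, fun u _ => hρ u⟩
  set Φ := WeilDeligneRep.geomFrob F hex'
  have hev : Module.End.HasEigenvalue (σ.restrictInertiaInvariantsKerN hn' Φ) 1 := by
    refine Module.End.hasEigenvalue_of_hasEigenvector (x := ⟨c, hc⟩) ⟨?_, fun h => hc0 ?_⟩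
    · rw [Module.End.mem_eigenspace_iff, one_smul]
      exact Subtype.ext (hρ Φ)
    · simpa using congrArg Subtype.val h
  have hroot := (Module.End.hasEigenvalue_iff_isRoot_charpoly _ _).mp hev
  intro h1
  rw [σ.eulerFactor_eq_reverse_charpoly hn' hex' (WeilDeligneRep.deg_geomFrob' hex')] at h1
  have h2 : ((σ.restrictInertiaInvariantsKerN hn' Φ).charpoly.reverse).eval 1 = 0 :=
    (eval_one_reverse_eq_zero_iff _).mpr hroot
  rw [h1, eval_one] at h2
  exact one_ne_zero h2

/-- **The canonical element of `V ⊗ T^∨`.**  For a `ρ(W_F)`-stable `T ≤ ker N`, the element of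
`V ⊗ T^∨` corresponding to the inclusion `T ↪ V` under `V ⊗ T^∨ ≃ Hom(T, V)` is non-zero
(`T ≠ 0`), fixed by `ρ(w) ⊗ ρ_T^∨(w)` and killed by `N ⊗ 1 + 1 ⊗ N_T^∨ = N ⊗ 1`. [folklore] -/
theorem exists_fixed_tprod_dual
    {F : Type} [Field F] [ValuativeRel F] [TopologicalSpace F] [IsNonarchimedeanLocalField F]
    (hmul' : @IsFrobPow.mul F _ _ _ _) (huniq' : @IsFrobPow.unique F _ _ _ _)
    {V : Type*} [AddCommGroup V] [Module ℂ V] [FiniteDimensional ℂ V] (φ : WeilDeligneRep F ℂ V)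
    {T : Submodule ℂ V} (hT0 : T ≠ ⊥) (hT : φ.IsSubrep T) (hker : T ≤ LinearMap.ker φ.N)
    (hNT : (φ.ofSubrep T hT).N = 0) :
    ∃ c : V ⊗[ℂ] Module.Dual ℂ T, c ≠ 0 ∧
      (φ.tprod ((φ.ofSubrep T hT).dual hmul' huniq')).N c = 0 ∧
      ∀ w, (φ.tprod ((φ.ofSubrep T hT).dual hmul' huniq')).ρ w c = c := by
  set φT := φ.ofSubrep T hT
  -- `Θ : V ⊗ T^∨ ≃ Hom(T, V)`, `v ⊗ f ↦ (t ↦ f t • v)` (Mathlib `dualTensorHomEquiv`)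
  obtain ⟨Θ, hΘ⟩ : ∃ Θ : V ⊗[ℂ] Module.Dual ℂ T ≃ₗ[ℂ] (T →ₗ[ℂ] V),
      ∀ (v : V) (f : Module.Dual ℂ T), Θ (v ⊗ₜ f) = dualTensorHom ℂ T V (f ⊗ₜ v) :=
    ⟨(TensorProduct.comm ℂ V (Module.Dual ℂ T)).trans (dualTensorHomEquiv ℂ T V), fun v f => by
      simp [dualTensorHomEquiv]⟩
  -- `Θ` carries `A ⊗ Bᵀ` to `g ↦ A ∘ g ∘ B`
  have hΘmap : ∀ (A : V →ₗ[ℂ] V) (B : T →ₗ[ℂ] T) (x : V ⊗[ℂ] Module.Dual ℂ T),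
      Θ (TensorProduct.map A B.dualMap x) = A ∘ₗ Θ x ∘ₗ B := by
    intro A B x
    induction x using TensorProduct.induction_on with
    | zero => simp
    | tmul v f =>
      rw [TensorProduct.map_tmul, hΘ, hΘ]
      ext t
      simp
    | add x y hx hy => simp only [map_add, hx, hy, LinearMap.add_comp, LinearMap.comp_add]
  have hΘN : ∀ x, Θ (TensorProduct.map φ.N (1 : Module.End ℂ (Module.Dual ℂ T)) x) =
      φ.N ∘ₗ Θ x := fun x => by
    have h := hΘmap φ.N LinearMap.id x
    rw [LinearMap.dualMap_id, LinearMap.comp_id] at h; exact h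
  have hsub : ∀ w, φ.ρ w ∘ₗ T.subtype = T.subtype ∘ₗ φT.ρ w := fun w => LinearMap.ext fun _ => rfl
  have hNsub : φ.N ∘ₗ T.subtype = 0 := by
    ext ⟨t, ht⟩
    exact LinearMap.mem_ker.mp (hker ht)
  refine ⟨Θ.symm T.subtype, fun h => hT0 ?_, ?_, fun w => ?_⟩
  · -- `c ≠ 0` since `T ≠ 0`
    have h0 : T.subtype = 0 := by rw [← Θ.apply_symm_apply T.subtype, h, map_zero]
    rw [eq_bot_iff]
    intro t ht
    simpa using congr($h0 ⟨t, ht⟩)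
  · -- `(N ⊗ 1 + 1 ⊗ N_T^∨) c = (N ⊗ 1) c ↔ N ∘ ι_T = 0`
    rw [WeilDeligneRep.tprod_N, WeilDeligneRep.dual_N, hNT, LinearMap.dualMap_def, map_zero,
      neg_zero, TensorProduct.map_zero_right, add_zero]
    apply Θ.injective
    rw [map_zero, hΘN, Θ.apply_symm_apply, hNsub]
  · -- `(ρ w ⊗ ρ_T(w⁻¹)ᵀ) c = c ↔ ρ w ∘ ι_T ∘ ρ_T w⁻¹ = ι_T`
    apply Θ.injective
    rw [WeilDeligneRep.tprod_ρ_apply, WeilDeligneRep.dual_ρ, Representation.dual_apply,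
      ← LinearMap.dualMap_def, hΘmap, Θ.apply_symm_apply, ← LinearMap.comp_assoc, hsub w,
      LinearMap.comp_assoc, ← Module.End.mul_eq_comp, ← map_mul, mul_inv_cancel, map_one,
      Module.End.one_eq_id, LinearMap.comp_id]

/-- `s ⊗ r ≅ s ⊗ r'` for `r ≅ r'` (proof adapted from the tree's
`ReciprocityRigidity.isEquivalent_tprod_right`, whose module has a heavy import closure).
[folklore] -/
theorem isEquivalent_tprod_right'
    {F : Type} [Field F] [ValuativeRel F] [TopologicalSpace F] [IsNonarchimedeanLocalField F]
    {V : Type*} [AddCommGroup V] [Module ℂ V] {W : Type*} [AddCommGroup W] [Module ℂ W]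
    {W' : Type*} [AddCommGroup W'] [Module ℂ W'] (s : WeilDeligneRep F ℂ V)
    {r : WeilDeligneRep F ℂ W} {r' : WeilDeligneRep F ℂ W'} (h : r.IsEquivalent r') :
    (s.tprod r).IsEquivalent (s.tprod r') := by
  obtain ⟨e⟩ := h
  let erep : Representation.Equiv (s.tprod r).ρ (s.tprod r').ρ :=
    Representation.Equiv.mk (TensorProduct.congr (LinearEquiv.refl ℂ V) e.toLinearEquiv)
      (fun w => TensorProduct.ext' fun x v => by
        have h1 := e.toIntertwiningMap.isIntertwining r.ρ r'.ρ w v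
        rw [Representation.Equiv.coe_toIntertwiningMap] at h1
        simp only [LinearMap.coe_comp, Function.comp_apply, LinearEquiv.coe_coe,
          WeilDeligneRep.tprod_ρ_apply, TensorProduct.map_tmul, TensorProduct.congr_tmul,
          LinearEquiv.refl_apply]
        congr 1)
  refine ⟨{ toRepEquiv := erep, comm_N := TensorProduct.ext' fun x v => ?_ }⟩
  have h1 : e.toLinearEquiv (r.N v) = r'.N (e.toLinearEquiv v) := congr($(e.comm_N) v)
  rw [Representation.Equiv.toLinearEquiv_apply] at h1
  change TensorProduct.congr (LinearEquiv.refl ℂ V) e.toLinearEquiv ((s.tprod r).N (x ⊗ₜ v)) =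
    (s.tprod r').N (TensorProduct.congr (LinearEquiv.refl ℂ V) e.toLinearEquiv (x ⊗ₜ v))
  simp only [WeilDeligneRep.tprod_N, LinearMap.add_apply, TensorProduct.map_tmul, map_add,
    TensorProduct.congr_tmul, LinearEquiv.refl_apply, Module.End.one_apply,
    Representation.Equiv.toLinearEquiv_apply, h1]

/-- **Stub E2 (Henniart 2002, Thm 1.6 (a), (ii) ⇒ (i)): a reducible Frobenius-semisimple
Weil–Deligne representation is detected by an irreducible Frobenius-semisimple probe of smaller
positive dimension.**  Take a minimal non-zero `W_F`-stable `T ≤ ker N` (an irreducible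
sub-Weil–Deligne representation, proper since `φ` is not irreducible) and probe with the
contragredient `τ := T^∨` transported to `ℂ^m`, `m = dim T`: the canonical element of
`T ⊗ T^∨ ≤ φ ⊗ τ` is `W_F`-invariant and killed by the monodromy, so the geometric Frobenius has
the eigenvalue `1` on `(ker N)^{I_F}` and `det(1 - X·Φ) ≠ 1`.
[cite: HenniartBSMF2002, Thm 1.6 (a)] -/
theorem stub_exists_eulerFactor_tprod_ne_one_of_not_isIrreducible :
    ∀ (F : Type) [Field F] [ValuativeRel F] [TopologicalSpace F] [IsNonarchimedeanLocalField F]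
      (hmul : IsFrobPow.mul (F := F)) (huniq : IsFrobPow.unique (F := F))
      (hn : absInertia_normal F) (hex : exists_isFrobPow (F := F))
      (V : Type) [AddCommGroup V] [Module ℂ V] [FiniteDimensional ℂ V] [Nontrivial V]
      (φ : WeilDeligneRep F ℂ V), φ.IsFrobSemisimple → ¬ φ.IsIrreducible →
      ∃ m : ℕ, 0 < m ∧ m < Module.finrank ℂ V ∧ ∃ τ : WeilDeligneRep F ℂ (Fin m → ℂ),
        τ.IsIrreducible ∧ τ.IsFrobSemisimple ∧ (φ.tprod τ).eulerFactor hn hex ≠ 1 := by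
  intro F _ _ _ _ hmul huniq hn hex V _ _ _ _ φ hfs hirr
  -- (1)–(2) a minimal non-zero `W_F`-stable `T ≤ ker N`
  obtain ⟨T, hT0, hTst, hTker, hmin⟩ := exists_minimal_stable_le_ker φ
  obtain ⟨hT, hNT⟩ := isSubrep_of_le_ker φ hTst hTker
  -- (3) `T ≠ ⊤` since `φ` is not irreducible
  have hTtop : T ≠ ⊤ := by
    intro htop
    refine hirr ⟨inferInstance, fun p hp => ?_⟩
    by_cases hp0 : p = ⊥
    · exact Or.inl hp0
    · exact Or.inr ((hmin p hp0 hp.1 (htop ▸ le_top)).trans htop)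
  set m := finrank ℂ T
  have hmpos : 0 < m := Nat.pos_of_ne_zero fun h => hT0 (Submodule.finrank_eq_zero.mp h)
  have hmlt : m < finrank ℂ V := Submodule.finrank_lt hTtop
  haveI : Nontrivial T := Submodule.nontrivial_iff_ne_bot.mpr hT0
  -- the irreducible sub-Weil–Deligne representation on `T` and its contragredient
  set φT := φ.ofSubrep T hT
  set τ₀ := φT.dual hmul huniq with hτ₀
  have hN0 : τ₀.N = 0 := by
    rw [hτ₀, WeilDeligneRep.dual_N, hNT, LinearMap.dualMap_def, map_zero, neg_zero]
  have hirrT : ∀ q : Submodule ℂ T, (∀ w, q ≤ q.comap (φT.ρ w)) → q = ⊥ ∨ q = ⊤ :=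
    stable_ofSubrep_eq_bot_or_top φ hT hmin
  have hirr₀ : τ₀.IsIrreducible :=
    ⟨inferInstance, fun q hq => stable_dual_eq_bot_or_top hmul huniq φT hirrT q hq.1⟩
  have hfs₀ : τ₀.IsFrobSemisimple :=
    isFrobSemisimple_dual hmul huniq φT (isFrobSemisimple_ofSubrep φ hT hfs)
  -- (4) transport to `Fin m → ℂ`
  let e : Module.Dual ℂ T ≃ₗ[ℂ] (Fin m → ℂ) :=
    LinearEquiv.ofFinrankEq _ _ (by rw [Subspace.dual_finrank_eq, Module.finrank_fin_fun])
  obtain ⟨τ, ⟨eτ⟩⟩ := exists_isEquivalent_of_linearEquiv τ₀ hN0 e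
  refine ⟨m, hmpos, hmlt, τ, isIrreducible_of_equiv eτ hirr₀, isFrobSemisimple_of_equiv eτ hfs₀,
    ?_⟩
  -- (5) the pole
  rw [← stub_eulerFactor_eq_of_isEquivalent hn hex (isEquivalent_tprod_right' φ ⟨eτ⟩)]
  obtain ⟨c, hc0, hNc, hρc⟩ := exists_fixed_tprod_dual hmul huniq φ hT0 hT hTker hNT
  exact eulerFactor_ne_one_of_fixed hn hex _ hc0 hNc hρc

end Summit.Langlands.Langlands.Theorems.ReciprocityUpToIrreducibilityR

end
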